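import Summits.CriticalPhenomena.PercolationContinuityZ3.Theorems.PercNearOneGluingNoHeavyLowerTailWorstFirstGluing
import Literature.Probability.Percolation.FoldingFibresHarris
import HarnessLib

/-!
# `NoHeavyLowerTail` (stmt-CriticalPhenomena-4575) — COVARIANCE GLUING: the unweighted covariance form (U), a new and
# weaker sufficient condition for event gluing (all `|A|`), `AdditiveGluing` (stmt-4576) and `NoHeavyLowerTail`

Support file (prover prim-gen-kcluster gen 4, k-cluster conditional-association line; `--supports stmt-CriticalPhenomena-4575`).
No definitions, no named facts, no sorries.

Setting: `μ = prodBernoulli w` on `Fin n`, observer `o`, sink `c`, finite relay set `A`, `d_x := μ(x ↮ c)`.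
Rank the relays WORST FIRST (`x` precedes `a` iff `d_x > d_a`, or `d_x = d_a` and `x < a`) and let

  `V_a := {o ↔ a} ∩ ⋂_{x ∈ A, x precedes a} {o ↮ x}`     ("`a` is the worst-ranked relay joined to `o`"),

so that `{o ↔ A} := ⋃_{a∈A} {o ↔ a}` is the DISJOINT union of the `V_a` (`reach_eq_sum_rankJ`), and on `V_a` one has
`o ↔ c ⇔ a ↔ c` (`rankJ_inter_conn_eq`).  The worst-first exit events of `…WorstFirstGluing` are `W_a = V_a ∩ {o ↮ c}`.

COVARIANCE GLUING (U):   `Σ_{a ∈ A} Cov(1_{V_a}, 1_{a ↔ c}) ≥ 0`,  i.e.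
   `Σ_{a∈A} μ(V_a) · μ(a ↔ c) ≤ μ({o ↔ c} ∩ {o ↔ A})`,   i.e.   `μ({o ↮ c} ∩ {o ↔ A}) ≤ Σ_{a∈A} μ(V_a) · d_a = E[d_J ; o ↔ A]`
("the exit probability is at most the expected unreliability of the WORST relay that `o` reaches").

* `eventGluing_of_covGluing`: (U) for all relay sets ⇒ EVENT GLUING `μ({o ↮ c} ∩ ⋃_{a∈A}{o ↔ a}) ≤ max_a d_a` for all relay
  sets (two lines: `X = Σ_a [μ(V_a) − μ(V_a ∩ {a ↔ c})] ≤ Σ_a μ(V_a)(1 − μ(a ↔ c)) ≤ (max d)·μ(o ↔ A)`), hence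
  `additiveGluing_of_covGluing` (stmt-4576) and `noHeavyLowerTail_of_covGluing` (stmt-4575) by the landed glue.
* `covGluing_singleton`: (U) for `|A| = 1` is Harris' inequality.
WHY THIS FORM.  (U) is implied by the seat's earlier conjectures ((R1_0) `Ψ ≤ μ(o ↔ A)` for all prefix sets, by Abel summation;
hence by (CM_k), (R1_A)) but NOT by (WF) `Ψ ≤ 1`, and it is the weakest member of the family that still gives event gluing with
constant 1: the only relay-selection rule `P ↦ t(P) ∈ P` with `μ({o↮c}∩{o↔A}) ≤ E[d_{t(C(o)∩A)}; o ↔ A]` true in the census is the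
worst-first one (best-first and pocket-average fail).  It has no conditioning and no division and is of degree 2 in the cell masses
(vs 3 for (WF)₃, 4 for (R1_A)₃).  Census (exact partition DP, seat folder num/t_U.py): 0 violations in ≈ 1.5·10³ instances, `n ≤ 8`,
`|A| ≤ 6`, random / two-scale / glued-locus weights; ttrl request `u-covariance-census-cert` filed for the exhaustive census and a
two-set-exchange certificate search at `|A| = 3`.
-/

noncomputable section

namespace Summit.CriticalPhenomena.PercolationContinuityZ3.Theorems

open MeasureTheory Set Literature.Probability.LatticeModels Literature.Probability.Percolation
open Summit.CriticalPhenomena.PercolationContinuityZ3.Theses.PercNearOneGluing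
open scoped Classical BigOperators

namespace CovarianceGluing

variable {n : ℕ}

/-- The worst-ranked-reached-relay events `V_a` of two distinct relays are disjoint (any ranking `r`). [this file] -/
theorem rankJ_event_disjoint (A : Finset (Fin n)) (o : Fin n) (r : Fin n → ℝ) {a a' : Fin n}
    (ha : a ∈ A) (ha' : a' ∈ A) (hne : a ≠ a') :
    Disjoint
      {ω : BondConfig (Fin n) | (openGraph ω).Reachable o a ∧
        ∀ x ∈ A, (openGraph ω).Reachable o x → (r x < r a ∨ (r x = r a ∧ a ≤ x))}
      {ω : BondConfig (Fin n) | (openGraph ω).Reachable o a' ∧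
        ∀ x ∈ A, (openGraph ω).Reachable o x → (r x < r a' ∨ (r x = r a' ∧ a' ≤ x))} := by
  rw [Set.disjoint_left]
  rintro ω ⟨hoa, hmax⟩ ⟨hoa', hmax'⟩
  rcases hmax a' ha' hoa' with h1 | ⟨h1, h1'⟩
  · rcases hmax' a ha hoa with h2 | ⟨h2, _⟩
    · exact absurd (lt_trans h1 h2) (lt_irrefl _)
    · rw [h2] at h1; exact absurd h1 (lt_irrefl _)
  · rcases hmax' a ha hoa with h2 | ⟨_, h2'⟩
    · rw [h1] at h2; exact absurd h2 (lt_irrefl _)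
    · exact hne (le_antisymm h1' h2')

/-- **Reach decomposition by the worst-ranked reached relay** (any ranking `r`):
`μ(⋃_{a∈A}{o ↔ a}) = Σ_{a∈A} μ(V_a)`. [this file] -/
theorem reach_eq_sum_rankJ (w : Sym2 (Fin n) → unitInterval) (A : Finset (Fin n)) (o : Fin n) (r : Fin n → ℝ) :
    (prodBernoulli w).real (⋃ a ∈ A, (openConn o a : Set (BondConfig (Fin n)))) =
      ∑ a ∈ A, (prodBernoulli w).real
        {ω : BondConfig (Fin n) | (openGraph ω).Reachable o a ∧
          ∀ x ∈ A, (openGraph ω).Reachable o x → (r x < r a ∨ (r x = r a ∧ a ≤ x))} := by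
  rw [← measureReal_biUnion_finset ?_ (fun _ _ => MeasurableSet.of_discrete)]
  · congr 1
    ext ω
    simp only [mem_iUnion, exists_prop, mem_setOf_eq]
    constructor
    · rintro ⟨a, haA, hoa⟩
      set P : Finset (Fin n) := A.filter (fun x => (openGraph ω).Reachable o x) with hP
      have hPne : P.Nonempty := ⟨a, Finset.mem_filter.2 ⟨haA, hoa⟩⟩
      obtain ⟨m, hmP, hm⟩ := WorstFirstGluing.exists_rank_max P hPne r
      refine ⟨m, (Finset.mem_filter.1 hmP).1, (Finset.mem_filter.1 hmP).2, ?_⟩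
      intro x hx hox
      exact hm x (Finset.mem_filter.2 ⟨hx, hox⟩)
    · rintro ⟨a, haA, hoa, _⟩
      exact ⟨a, haA, hoa⟩
  · intro a ha a' ha' hne
    exact rankJ_event_disjoint A o r ha ha' hne

/-- **Through decomposition**: `μ({o ↔ c} ∩ ⋃_{a∈A}{o ↔ a}) = Σ_{a∈A} μ(V_a ∩ {a ↔ c})`
(on `V_a`, `o ↔ c ⇔ a ↔ c`). [this file] -/
theorem through_eq_sum_rankJ (w : Sym2 (Fin n) → unitInterval) (A : Finset (Fin n)) (o c : Fin n) (r : Fin n → ℝ) :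
    (prodBernoulli w).real ((openConn o c : Set (BondConfig (Fin n))) ∩ ⋃ a ∈ A, openConn o a) =
      ∑ a ∈ A, (prodBernoulli w).real
        ({ω : BondConfig (Fin n) | (openGraph ω).Reachable o a ∧
          ∀ x ∈ A, (openGraph ω).Reachable o x → (r x < r a ∨ (r x = r a ∧ a ≤ x))} ∩
          (openConn a c : Set (BondConfig (Fin n)))) := by
  rw [← measureReal_biUnion_finset ?_ (fun _ _ => MeasurableSet.of_discrete)]
  · congr 1
    ext ω
    simp only [mem_inter_iff, mem_iUnion, exists_prop, mem_setOf_eq]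
    constructor
    · rintro ⟨hoc, a, haA, hoa⟩
      set P : Finset (Fin n) := A.filter (fun x => (openGraph ω).Reachable o x) with hP
      have hPne : P.Nonempty := ⟨a, Finset.mem_filter.2 ⟨haA, hoa⟩⟩
      obtain ⟨m, hmP, hm⟩ := WorstFirstGluing.exists_rank_max P hPne r
      refine ⟨m, (Finset.mem_filter.1 hmP).1, ⟨(Finset.mem_filter.1 hmP).2, ?_⟩, ?_⟩
      · intro x hx hox
        exact hm x (Finset.mem_filter.2 ⟨hx, hox⟩)
      · exact SimpleGraph.Reachable.trans (SimpleGraph.Reachable.symm (Finset.mem_filter.1 hmP).2) hoc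
    · rintro ⟨a, haA, ⟨hoa, _⟩, hac⟩
      exact ⟨SimpleGraph.Reachable.trans hoa hac, a, haA, hoa⟩
  · intro a ha a' ha' hne
    exact Disjoint.mono inter_subset_left inter_subset_left (rankJ_event_disjoint A o r ha ha' hne)

/-- The worst-first EXIT event is the reached-relay event minus its through part:
`μ(W_a) = μ(V_a) − μ(V_a ∩ {a ↔ c})`. [this file] -/
theorem exit_term_eq (w : Sym2 (Fin n) → unitInterval) (A : Finset (Fin n)) (o c a : Fin n) (r : Fin n → ℝ) :
    (prodBernoulli w).real
        {ω : BondConfig (Fin n) | (openGraph ω).Reachable o a ∧ ¬ (openGraph ω).Reachable o c ∧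
          ∀ x ∈ A, (openGraph ω).Reachable o x → (r x < r a ∨ (r x = r a ∧ a ≤ x))} =
      (prodBernoulli w).real
        {ω : BondConfig (Fin n) | (openGraph ω).Reachable o a ∧
          ∀ x ∈ A, (openGraph ω).Reachable o x → (r x < r a ∨ (r x = r a ∧ a ≤ x))} -
      (prodBernoulli w).real
        ({ω : BondConfig (Fin n) | (openGraph ω).Reachable o a ∧
          ∀ x ∈ A, (openGraph ω).Reachable o x → (r x < r a ∨ (r x = r a ∧ a ≤ x))} ∩
          (openConn a c : Set (BondConfig (Fin n)))) := by
  set μ := prodBernoulli w with hμ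
  set V : Set (BondConfig (Fin n)) := {ω | (openGraph ω).Reachable o a ∧
          ∀ x ∈ A, (openGraph ω).Reachable o x → (r x < r a ∨ (r x = r a ∧ a ≤ x))} with hV
  have hsplit : {ω : BondConfig (Fin n) | (openGraph ω).Reachable o a ∧ ¬ (openGraph ω).Reachable o c ∧
          ∀ x ∈ A, (openGraph ω).Reachable o x → (r x < r a ∨ (r x = r a ∧ a ≤ x))} =
      V \ (V ∩ (openConn a c : Set (BondConfig (Fin n)))) := by
    ext ω
    simp only [hV, mem_sdiff, mem_inter_iff, mem_setOf_eq, openConn]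
    constructor
    · rintro ⟨hoa, hoc, hmax⟩
      exact ⟨⟨hoa, hmax⟩, fun h => hoc (SimpleGraph.Reachable.trans hoa h.2)⟩
    · rintro ⟨⟨hoa, hmax⟩, hnot⟩
      refine ⟨hoa, fun hoc => hnot ⟨⟨hoa, hmax⟩, ?_⟩, hmax⟩
      exact SimpleGraph.Reachable.trans (SimpleGraph.Reachable.symm hoa) hoc
  rw [hsplit, measureReal_sdiff inter_subset_left MeasurableSet.of_discrete]

/-- **Covariance gluing ⇒ event gluing (all relay sets).**  Hypothesis (verbatim the conjecture (U), index tie-break):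
for every finite weighted graph, observer `o`, sink `c` and relay set `A`,
`Σ_{a ∈ A} μ(V_a) · μ(a ↔ c) ≤ μ({o ↔ c} ∩ ⋃_{a∈A}{o ↔ a})`, where
`V_a = {o ↔ a, and every relay x ∈ A with o ↔ x has (d_x < d_a or (d_x = d_a and a ≤ x))}`
(`a` is the worst-ranked relay joined to `o`).  Conclusion: event gluing `μ({o ↮ c} ∩ ⋃_{a∈A}{o ↔ a}) ≤ s` whenever
`μ(a ↮ c) ≤ s` on `A`.  Proof: `X = Σ_a [μ(V_a) − μ(V_a ∩ {a↔c})] ≤ Σ_a μ(V_a)·μ(a ↮ c) ≤ s·μ(o ↔ A) ≤ s`. [this file] -/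
theorem eventGluing_of_covGluing
    (hU : ∀ (n : ℕ) (w : Sym2 (Fin n) → unitInterval) (A : Finset (Fin n)) (o c : Fin n),
      ∑ a ∈ A, (prodBernoulli w).real
          {ω : BondConfig (Fin n) | (openGraph ω).Reachable o a ∧
            ∀ x ∈ A, (openGraph ω).Reachable o x →
              ((prodBernoulli w).real (openConn x c : Set (BondConfig (Fin n)))ᶜ <
                  (prodBernoulli w).real (openConn a c : Set (BondConfig (Fin n)))ᶜ ∨
               ((prodBernoulli w).real (openConn x c : Set (BondConfig (Fin n)))ᶜ =
                  (prodBernoulli w).real (openConn a c : Set (BondConfig (Fin n)))ᶜ ∧ a ≤ x))} *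
        (prodBernoulli w).real (openConn a c : Set (BondConfig (Fin n))) ≤
      (prodBernoulli w).real ((openConn o c : Set (BondConfig (Fin n))) ∩ ⋃ a ∈ A, openConn o a)) :
    ∀ (n : ℕ) (w : Sym2 (Fin n) → unitInterval) (A : Finset (Fin n)) (o c : Fin n) (s : ℝ), 0 ≤ s →
      (∀ a ∈ A, (prodBernoulli w).real (openConn a c : Set (BondConfig (Fin n)))ᶜ ≤ s) →
      (prodBernoulli w).real ((openConn o c : Set (BondConfig (Fin n)))ᶜ ∩ ⋃ a ∈ A, openConn o a) ≤ s := by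
  intro n w A o c s hs hcut
  haveI : IsProbabilityMeasure (prodBernoulli w) := inferInstance
  set μ := prodBernoulli w with hμ
  set r : Fin n → ℝ := fun x => μ.real (openConn x c : Set (BondConfig (Fin n)))ᶜ with hr
  have h := hU n w A o c
  -- exit = Σ_a μ(W_a) = Σ_a [μ(V_a) − μ(V_a ∩ {a↔c})]
  rw [WorstFirstGluing.exit_eq_sum_rank w A o c r]
  have hterm : ∀ a ∈ A, μ.real
        {ω : BondConfig (Fin n) | (openGraph ω).Reachable o a ∧ ¬ (openGraph ω).Reachable o c ∧
          ∀ x ∈ A, (openGraph ω).Reachable o x → (r x < r a ∨ (r x = r a ∧ a ≤ x))} =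
      μ.real {ω : BondConfig (Fin n) | (openGraph ω).Reachable o a ∧
          ∀ x ∈ A, (openGraph ω).Reachable o x → (r x < r a ∨ (r x = r a ∧ a ≤ x))} -
      μ.real ({ω : BondConfig (Fin n) | (openGraph ω).Reachable o a ∧
          ∀ x ∈ A, (openGraph ω).Reachable o x → (r x < r a ∨ (r x = r a ∧ a ≤ x))} ∩
          (openConn a c : Set (BondConfig (Fin n)))) := fun a _ => exit_term_eq w A o c a r
  rw [Finset.sum_congr rfl hterm, Finset.sum_sub_distrib, ← through_eq_sum_rankJ w A o c r]
  -- Σ μ(V_a) μ(a↔c) ≤ through, and μ(V_a) μ(a↔c) = μ(V_a) − μ(V_a) d_a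
  have hsum : ∑ a ∈ A, μ.real {ω : BondConfig (Fin n) | (openGraph ω).Reachable o a ∧
          ∀ x ∈ A, (openGraph ω).Reachable o x → (r x < r a ∨ (r x = r a ∧ a ≤ x))} -
      μ.real ((openConn o c : Set (BondConfig (Fin n))) ∩ ⋃ a ∈ A, openConn o a) ≤
      ∑ a ∈ A, μ.real {ω : BondConfig (Fin n) | (openGraph ω).Reachable o a ∧
          ∀ x ∈ A, (openGraph ω).Reachable o x → (r x < r a ∨ (r x = r a ∧ a ≤ x))} * r a := by
    have hrw : ∀ a ∈ A, μ.real {ω : BondConfig (Fin n) | (openGraph ω).Reachable o a ∧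
          ∀ x ∈ A, (openGraph ω).Reachable o x → (r x < r a ∨ (r x = r a ∧ a ≤ x))} * r a =
        μ.real {ω : BondConfig (Fin n) | (openGraph ω).Reachable o a ∧
          ∀ x ∈ A, (openGraph ω).Reachable o x → (r x < r a ∨ (r x = r a ∧ a ≤ x))} -
        μ.real {ω : BondConfig (Fin n) | (openGraph ω).Reachable o a ∧
          ∀ x ∈ A, (openGraph ω).Reachable o x → (r x < r a ∨ (r x = r a ∧ a ≤ x))} *
          μ.real (openConn a c : Set (BondConfig (Fin n))) := by
      intro a _
      have hc : r a = 1 - μ.real (openConn a c : Set (BondConfig (Fin n))) := by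
        simp only [hr]
        exact probReal_compl_eq_one_sub MeasurableSet.of_discrete
      rw [hc]; ring
    rw [Finset.sum_congr rfl hrw, Finset.sum_sub_distrib]
    linarith [h]
  refine le_trans hsum ?_
  -- Σ μ(V_a) r a ≤ Σ μ(V_a) s = s μ(o ↔ A) ≤ s
  calc ∑ a ∈ A, μ.real {ω : BondConfig (Fin n) | (openGraph ω).Reachable o a ∧
          ∀ x ∈ A, (openGraph ω).Reachable o x → (r x < r a ∨ (r x = r a ∧ a ≤ x))} * r a
      ≤ ∑ a ∈ A, μ.real {ω : BondConfig (Fin n) | (openGraph ω).Reachable o a ∧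
          ∀ x ∈ A, (openGraph ω).Reachable o x → (r x < r a ∨ (r x = r a ∧ a ≤ x))} * s := by
        refine Finset.sum_le_sum fun a ha => ?_
        exact mul_le_mul_of_nonneg_left (hcut a ha) measureReal_nonneg
    _ = (∑ a ∈ A, μ.real {ω : BondConfig (Fin n) | (openGraph ω).Reachable o a ∧
          ∀ x ∈ A, (openGraph ω).Reachable o x → (r x < r a ∨ (r x = r a ∧ a ≤ x))}) * s := by
        rw [Finset.sum_mul]
    _ = μ.real (⋃ a ∈ A, (openConn o a : Set (BondConfig (Fin n)))) * s := by
        rw [reach_eq_sum_rankJ w A o r]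
    _ ≤ 1 * s := mul_le_mul_of_nonneg_right measureReal_le_one hs
    _ = s := one_mul s

/-- **Covariance gluing ⇒ `AdditiveGluing`** (stmt-CriticalPhenomena-4576). [this file] -/
theorem additiveGluing_of_covGluing
    (hU : ∀ (n : ℕ) (w : Sym2 (Fin n) → unitInterval) (A : Finset (Fin n)) (o c : Fin n),
      ∑ a ∈ A, (prodBernoulli w).real
          {ω : BondConfig (Fin n) | (openGraph ω).Reachable o a ∧
            ∀ x ∈ A, (openGraph ω).Reachable o x →
              ((prodBernoulli w).real (openConn x c : Set (BondConfig (Fin n)))ᶜ <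
                  (prodBernoulli w).real (openConn a c : Set (BondConfig (Fin n)))ᶜ ∨
               ((prodBernoulli w).real (openConn x c : Set (BondConfig (Fin n)))ᶜ =
                  (prodBernoulli w).real (openConn a c : Set (BondConfig (Fin n)))ᶜ ∧ a ≤ x))} *
        (prodBernoulli w).real (openConn a c : Set (BondConfig (Fin n))) ≤
      (prodBernoulli w).real ((openConn o c : Set (BondConfig (Fin n))) ∩ ⋃ a ∈ A, openConn o a)) :
    Summit.CriticalPhenomena.PercolationContinuityZ3.Theses.PercNearOneGluing.AdditiveGluing :=
  additiveGluing_of_eventGluing (eventGluing_of_covGluing hU)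

/-- **Covariance gluing ⇒ `NoHeavyLowerTail`** (stmt-CriticalPhenomena-4575), through the landed glue
`event gluing ⇒ AdditiveGluing ⇒ NearOneGluing ⇒ residual ⇒ crux`. [this file] -/
theorem noHeavyLowerTail_of_covGluing
    (hU : ∀ (n : ℕ) (w : Sym2 (Fin n) → unitInterval) (A : Finset (Fin n)) (o c : Fin n),
      ∑ a ∈ A, (prodBernoulli w).real
          {ω : BondConfig (Fin n) | (openGraph ω).Reachable o a ∧
            ∀ x ∈ A, (openGraph ω).Reachable o x →
              ((prodBernoulli w).real (openConn x c : Set (BondConfig (Fin n)))ᶜ <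
                  (prodBernoulli w).real (openConn a c : Set (BondConfig (Fin n)))ᶜ ∨
               ((prodBernoulli w).real (openConn x c : Set (BondConfig (Fin n)))ᶜ =
                  (prodBernoulli w).real (openConn a c : Set (BondConfig (Fin n)))ᶜ ∧ a ≤ x))} *
        (prodBernoulli w).real (openConn a c : Set (BondConfig (Fin n))) ≤
      (prodBernoulli w).real ((openConn o c : Set (BondConfig (Fin n))) ∩ ⋃ a ∈ A, openConn o a)) :
    Summit.CriticalPhenomena.PercolationContinuityZ3.Theses.PercNearOneGluing.NoHeavyLowerTail :=
  noHeavyLowerTail_of_eventGluing (eventGluing_of_covGluing hU)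

/-- **(U) for a single relay is Harris' inequality**: `μ(o ↔ a) · μ(a ↔ c) ≤ μ({o ↔ c} ∩ {o ↔ a})`
(both events increasing; `{o↔a} ∩ {a↔c} ⊆ {o↔c} ∩ {o↔a}`). [folklore] -/
theorem covGluing_singleton (w : Sym2 (Fin n) → unitInterval) (o c a : Fin n) :
    (prodBernoulli w).real (openConn o a : Set (BondConfig (Fin n))) *
        (prodBernoulli w).real (openConn a c : Set (BondConfig (Fin n))) ≤
      (prodBernoulli w).real ((openConn o c : Set (BondConfig (Fin n))) ∩ openConn o a) := by
  have hH := prodBernoulli_harris_via_fibres w (isUpperSet_openConn o a) (isUpperSet_openConn a c)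
  refine le_trans hH (measureReal_mono ?_)
  rintro ω ⟨hoa, hac⟩
  exact ⟨SimpleGraph.Reachable.trans hoa hac, hoa⟩

end CovarianceGluing

end Summit.CriticalPhenomena.PercolationContinuityZ3.Theorems

end
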